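import Summits.Ventures.HodgeRepro2.T5SU11SphericalTransformDecay

/-!
# The spherical transform of the decaying solution near its pole: blow-up at the edge, residue, monotonicity

Row 628's closed form `∫_0^∞ χ_λ φ_{λ′} sinh 2s ds = 1/(μ − μ′) = 1/((λ − λ′)(λ + λ′ − 2))` (`1 < λ′ < λ`) and
`∫_0^∞ χ_λ Ξ sinh 2s ds = 1/(λ − 1)²` read off:

* `tendsto_integral_sphDecay_mul_sph_one_nhdsGT_one` — **the `Ξ`-mass of `χ_λ` blows up at the spectral edge**:
  `∫ χ_λ Ξ sinh 2s ds → +∞` as `λ → 1⁺`;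
* `tendsto_sub_mul_integral_sphDecay_mul_sph` — **the residue at the pole `λ′ = λ`**: `(λ − λ′) ∫ χ_λ φ_{λ′} sinh 2s ds → 1/(2(λ − 1))`
  as `λ′ → λ⁻`;
* `integral_sphDecay_mul_sph_mono` — the transform is monotone in `λ′ ∈ (1, λ)`.

Nothing is claimed about (N).

Blind lane: Mathlib + the HodgeRepro2 prefix only; no sorry; axioms ⊆ {propext, Classical.choice,
Quot.sound}.
-/

namespace Summit.Ventures.HodgeRepro2.T5SU11SphericalTransformDecayPole

open Filter Topology MeasureTheory
open Set (Ioi Ioo)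
open T5SU11Cartan T5SU11SphericalFunction T5SU11SphericalDecay T5SU11SphericalTransformDecay

section measure

variable [MeasurableSpace Circle] [BorelSpace Circle]

/-- **The `Ξ`-mass of the decaying solution blows up at the spectral edge**: `∫_0^∞ χ_λ Ξ sinh 2s ds → +∞` as `λ → 1⁺`. -/
theorem tendsto_integral_sphDecay_mul_sph_one_nhdsGT_one :
    Tendsto (fun lam => ∫ s in Ioi 0, sphDecay lam s * sph 1 (hyp s) * Real.sinh (2 * s)) (𝓝[>] 1) atTop := by
  have h1 : Tendsto (fun lam : ℝ => (lam - 1) ^ 2) (𝓝[>] 1) (𝓝[>] 0) := by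
    rw [tendsto_nhdsWithin_iff]
    refine ⟨?_, ?_⟩
    · have : Tendsto (fun lam : ℝ => (lam - 1) ^ 2) (𝓝 1) (𝓝 ((1 - 1) ^ 2)) :=
        ((continuous_id.sub continuous_const).pow 2).tendsto 1
      simpa using this.mono_left nhdsWithin_le_nhds
    · filter_upwards [self_mem_nhdsWithin] with lam hlam
      have hlam' : (0 : ℝ) < lam - 1 := sub_pos.mpr hlam
      exact pow_pos hlam' 2
  have h2 := tendsto_inv_nhdsGT_zero.comp h1
  refine h2.congr' ?_
  filter_upwards [self_mem_nhdsWithin] with lam hlam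
  simp only [Function.comp]
  rw [integral_sphDecay_mul_sph_one_eq hlam, one_div]

variable {lam : ℝ} (hlam : 1 < lam)

include hlam in
/-- **The residue of the spherical transform of `χ_λ` at the pole `λ′ = λ`**:
`(λ − λ′) ∫_0^∞ χ_λ φ_{λ′} sinh 2s ds → 1/(2(λ − 1))` as `λ′ → λ⁻`. -/
theorem tendsto_sub_mul_integral_sphDecay_mul_sph :
    Tendsto (fun lam' => (lam - lam') * ∫ s in Ioi 0, sphDecay lam s * sph lam' (hyp s) * Real.sinh (2 * s))
      (𝓝[<] lam) (𝓝 (1 / (2 * (lam - 1)))) := by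
  have h : Tendsto (fun lam' : ℝ => 1 / (lam + lam' - 2)) (𝓝[<] lam) (𝓝 (1 / (lam + lam - 2))) := by
    have hc : Continuous (fun lam' : ℝ => lam + lam' - 2) := (continuous_const.add continuous_id).sub continuous_const
    have hne : lam + lam - 2 ≠ 0 := by linarith
    have hcont : ContinuousAt (fun lam' : ℝ => 1 / (lam + lam' - 2)) lam :=
      continuousAt_const.div hc.continuousAt hne
    exact hcont.tendsto.mono_left nhdsWithin_le_nhds
  have e : 1 / (lam + lam - 2) = 1 / (2 * (lam - 1)) := by ring_nf
  rw [e] at h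
  refine h.congr' ?_
  filter_upwards [Ioo_mem_nhdsLT hlam] with lam' hlam'
  rw [integral_sphDecay_mul_sph_eq hlam hlam'.1 hlam'.2]
  have hne1 : lam - lam' ≠ 0 := sub_ne_zero.mpr (ne_of_gt hlam'.2)
  have hne2 : lam + lam' - 2 ≠ 0 := by linarith [hlam'.1]
  have e2 : lam * (lam - 2) - lam' * (lam' - 2) = (lam - lam') * (lam + lam' - 2) := by ring
  rw [e2]
  field_simp

include hlam in
/-- The spherical transform of `χ_λ` is monotone in `λ′ ∈ (1, λ)`. -/
theorem integral_sphDecay_mul_sph_mono {lam₁ lam₂ : ℝ} (h1 : 1 < lam₁) (h12 : lam₁ ≤ lam₂) (h2 : lam₂ < lam) :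
    ∫ s in Ioi 0, sphDecay lam s * sph lam₁ (hyp s) * Real.sinh (2 * s)
      ≤ ∫ s in Ioi 0, sphDecay lam s * sph lam₂ (hyp s) * Real.sinh (2 * s) := by
  rw [integral_sphDecay_mul_sph_eq hlam h1 (lt_of_le_of_lt h12 h2), integral_sphDecay_mul_sph_eq hlam (by linarith) h2]
  apply one_div_le_one_div_of_le
  · have e : lam * (lam - 2) - lam₂ * (lam₂ - 2) = (lam - lam₂) * (lam + lam₂ - 2) := by ring
    rw [e]
    exact mul_pos (by linarith) (by linarith)
  · nlinarith

end measure

end Summit.Ventures.HodgeRepro2.T5SU11SphericalTransformDecayPole
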